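import Summits.BirchSwinnertonDyer.BirchSwinnertonDyer.Theorems.KatoDescentPotSupersingularMuCoreIrrCore
import Summits.BirchSwinnertonDyer.BirchSwinnertonDyer.Theorems.KatoDescentPotSupersingularSmallImageEulerSystemDivisibilityIrreducible
import Literature.NumberTheory.EllipticCurves.KatoFineSelmerDualProofs
import Literature.NumberTheory.EllipticCurves.IwasawaModuleFinitePadicIntProofs
import Literature.NumberTheory.EllipticCurves.TateModuleContinuityProofs
import Literature.NumberTheory.EllipticCurves.TateModuleFreeProofs
import Literature.NumberTheory.EllipticCurves.Kato2004.IwasawaCohomologyExistsProofs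
import HarnessLib

/-!
# Coates–Sujatha's statement (A) at `p = 3` — `X₀(W/ℚ_∞)` finitely generated over `ℤ₃` — for EVERY `E/ℚ` with
# `E[3]` IRREDUCIBLE, from ONE `3`-indivisible genuine Λ-adic Euler-system class; UNCONDITIONAL kernel theorem
# (route `KatoDescentPotSupersingular`, items stmt-BirchSwinnertonDyer-19197 (U₀ parent) / 19189 (U₀-ns node) /
# 19942 `WildCoatesSujathaResidue` (Conj-A residue); route-free helper)

Seat `bsd-potss-k9-c4` g14 (prover; cell `bsd-potss`); `--supports stmt-BirchSwinnertonDyer-19197 --as helper`;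
closes nothing.  HONEST FRAMING: BSD is not proved by any of this; nothing is booked; Conjecture A is NOT proved —
it is REDUCED, on every `E[3]`-irreducible curve, to the displayed hypothesis «some genuine Λ-adic Euler-system class
in `𝐇¹_Γ(T_3W)` lies outside `3·𝐇¹_Γ`» (for Kato's zeta class: «`μ` of the zeta ideal `= 0`»), which is NOT supplied.
THEOREMS ONLY.  The engine is the K6 kernel `μ`-core re-run under `E[3]` irreducible alone
(`CoreAssembly.coreThree_anyReduction_of_irr`, part G of the `…MuCoreIrr*` chain, k9-c4 g14; mathematics of cells
`bsd-smallim` / `b2b-bsdres` / `bsd-stepL`, MU-TRANSFER-PROOF), followed by the tree's conversion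
`Sel₀(ℚ_∞, E[3^∞])[3]` finite ⟹ `X₀/3X₀` finite ⟹ `X₀` finitely generated over `ℤ₃`
(`FineSelmerDualData.finite_quotient_augIdealP_of_finite_pTorsion`, `…module_finite_of_finite_pTorsion`,
`IwasawaModuleFinitePadicInt.moduleFinite_padicInt_of_finite_quotient_augIdealP`).

* `moduleFinite_padicInt_fineSelmerDual_of_eulerClass_of_imageFacts` — every odd `p`, under the image facts
  (SC)/(IF) of part A;
* **`moduleFinite_padicInt_fineSelmerDual_of_eulerClass_three_of_irr`** — `p = 3`, `E[3]` irreducible (onto or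
  not), any cyclotomic `(κ, γ)`, pin `I`, datum `Y`: (∃ genuine Euler-system class `s ∉ 3𝐇¹_Γ`) ⟹
  `Module.Finite ℤ_[3] X₀` — statement (A) at `(W, 3)` in the tree's `∃ γ D` currency follows
  (`exists_fineSelmerDualData_moduleFinite_three_of_irr_of_eulerClass`);
* §3 `not_mem_augIdealP_smul_of_proj_ne[_smul_integral]` — the displayed hypothesis is certified at ANY finite
  layer: `proj_n s ∉ p·H¹(ℤ_n[1/p], T_pW)` ⟹ `s ∉ p·𝐇¹_Γ` (for Kato's class at level `0`: an `L`-value unit test);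
* reading for the planner (19942 / 19189 / 19197): on EVERY U₀-ns row (Cartan AND 9-deficient) the Conj-A residue
  `WildCoatesSujathaResidue` is implied by the single analytic statement «Kato's zeta class is `3`-indivisible in
  `𝐇¹_Γ`» — the conditional closer by name is the route-importing sibling
  `…WildCoatesSujathaResidueOfEulerClassIndivisible`.

References: [CoatesSujatha2005] §3, Conjecture A; [GreenbergLNM1716] §1 p. 60; [Washington1997] §13.2;
[Kato2004Asterisque] §12.2, §13.8; [Serre1972] §2.4–2.6.
-/

-- the summit and its single problem are both named `BirchSwinnertonDyer` (registry layout D-0017)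
set_option linter.dupNamespace false
set_option autoImplicit false

noncomputable section

open scoped NumberField
open Field IsDedekindDomain WeierstrassCurve
open Literature.NumberTheory.GaloisRepresentations Literature.NumberTheory.EllipticCurves
open Literature.NumberTheory.EllipticCurves.Kato2004 Literature.NumberTheory.EllipticCurves.Kato2004.EulerSystemValues
open Literature.NumberTheory.EllipticCurves.IwasawaAlgebra Literature.NumberTheory.EllipticCurves.IwasawaDual

namespace Summit.BirchSwinnertonDyer.BirchSwinnertonDyer.Theorems.MuCoreIrr

/-! ## §1 Statement (A) from a `p`-indivisible Euler-system class -/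

section ImageFacts

variable (W : WeierstrassCurve ℚ) [W.IsElliptic] [W.IsGloballyMinimal] (p : ℕ) [Fact p.Prime]
  [ContinuousSMul ℤ_[p] (W.tateModule p)] [Module.Free ℤ_[p] (W.tateModule p)]
  [Module.Finite ℤ_[p] (W.tateModule p)] {κ : ZpExtension ℚ p} {γ : absoluteGaloisGroup ℚ}

/-- **`X₀(W/ℚ_∞)` is finitely generated over `ℤ_p` from a `p`-indivisible genuine Euler-system class, under the
image facts (SC)/(IF)** (every odd `p`, `E[p]` irreducible; `μ`-core `coreIrr_anyReduction_holds` + the tree's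
`Sel₀[p]`-finite ⟹ `X₀/pX₀` finite ⟹ `ℤ_p`-finite conversion).  Unconditional given the displayed class.
[cite: GreenbergLNM1716, §1 p. 60 (after Conj. 1.3)] [cite: Washington1997, §13.2] [cite: Kato2004Asterisque, §13.8] -/
theorem moduleFinite_padicInt_fineSelmerDual_of_eulerClass_of_imageFacts (hp : p ≠ 2)
    (hκ : κ.IsCyclotomic) (hγ : κ.IsTopGenerator γ) (hirr : W.HasIrreducibleModPGaloisRep p)
    (hSC : ∃ (z : absoluteGaloisGroup ℚ) (a : ZMod p), a ≠ 1 ∧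
      ∀ P : WeierstrassCurve.geomTorsion W (p : ℤ), z • P = a.val • P)
    (hIF : ∀ N : Subgroup (absoluteGaloisGroup ℚ), N.Normal →
      (WeierstrassCurve.galoisRepTorsion W (p : ℕ)).ker ≤ N → N.index ≠ p)
    (I : IwasawaH1Data W p κ γ) (Y : W.FineSelmerDualData κ γ)
    (hs : ∃ s : I.H, IsEulerSystemClass W p κ γ I s ∧
      s ∉ IwasawaAlgebra.augIdealP p • (⊤ : Submodule (IwasawaAlgebra p) I.H)) :
    Module.Finite ℤ_[p] (RestrictScalars ℤ_[p] (IwasawaAlgebra p) Y.X) := by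
  obtain ⟨J, hJ⟩ :=
    Rank1Residual.CoreAssembly.coreIrr_anyReduction_holds W p κ γ I hp hirr hSC hIF hκ hγ hs
  have hfin := W.finite_fineSelmerInfty_pTorsion_of_forall_iterate_eq_zero κ hγ hJ
  haveI : Module.Finite (IwasawaAlgebra p) Y.X := Y.module_finite_of_finite_pTorsion hγ hfin
  exact IwasawaModuleFinitePadicInt.moduleFinite_padicInt_of_finite_quotient_augIdealP p Y.X
    (Y.finite_quotient_augIdealP_of_finite_pTorsion hfin)

end ImageFacts

/-! ## §2 At `p = 3` for every `E[3]`-irreducible curve -/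

section Three

variable (W : WeierstrassCurve ℚ) [W.IsElliptic] [W.IsGloballyMinimal] [Fact (Nat.Prime 3)]

/-- **Statement (A) at `p = 3` on EVERY `E[3]`-irreducible curve, from a `3`-indivisible genuine Euler-system class**
(`ρ̄_{E,3}` onto or not — 9-deficient and Cartan rows alike): `X₀(W/ℚ_∞)` is finitely generated over `ℤ₃` for every
dual fine Selmer datum.  UNCONDITIONAL given the displayed class (no Kato 13.4 fact, no Serre, no class-group
input). [cite: GreenbergLNM1716, §1 p. 60 (after Conj. 1.3)] [cite: Washington1997, §13.2]
[cite: Kato2004Asterisque, §13.8] [cite: Serre1972, §2.4 Prop. 15, §2.5–2.6] -/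
theorem moduleFinite_padicInt_fineSelmerDual_of_eulerClass_three_of_irr
    [ContinuousSMul ℤ_[3] (W.tateModule 3)] [Module.Free ℤ_[3] (W.tateModule 3)]
    [Module.Finite ℤ_[3] (W.tateModule 3)] {κ : ZpExtension ℚ 3} {γ : absoluteGaloisGroup ℚ}
    (hκ : κ.IsCyclotomic) (hγ : κ.IsTopGenerator γ) (hirr : W.HasIrreducibleModPGaloisRep 3)
    (I : IwasawaH1Data W 3 κ γ) (Y : W.FineSelmerDualData κ γ)
    (hs : ∃ s : I.H, IsEulerSystemClass W 3 κ γ I s ∧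
      s ∉ IwasawaAlgebra.augIdealP 3 • (⊤ : Submodule (IwasawaAlgebra 3) I.H)) :
    Module.Finite ℤ_[3] (RestrictScalars ℤ_[3] (IwasawaAlgebra 3) Y.X) :=
  moduleFinite_padicInt_fineSelmerDual_of_eulerClass_of_imageFacts W 3 (by decide) hκ hγ hirr
    (Rank1Residual.imageFactSC_three_of_irr W hirr)
    (IrrThreeDisjoint.forall_normal_index_ne_three_of_irr W hirr) I Y hs

/-- **Statement (A) at `(W, 3)` in the route items' `∃ γ D` currency**, for every `E[3]`-irreducible curve and every
cyclotomic `κ`, from the displayed hypothesis «for some topological generator `γ` and pin `I`, a genuine Euler-system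
class outside `3·𝐇¹_Γ`» — the instances on `T_3W` and the data `γ`, `I`, `D` all exist by tree theorems
(`TateModule.continuousSMul_padicInt`, `module_free/finite_tateModule_holds`, `κ.surjective`,
`nonempty_iwasawaH1Data_holds`, `nonempty_fineSelmerDualData`). [cite: CoatesSujatha2005, §3 and Conjecture A]
[cite: GreenbergLNM1716, §1 p. 60] [cite: Kato2004Asterisque, §12.2, §13.8] -/
theorem exists_fineSelmerDualData_moduleFinite_three_of_irr_of_eulerClass
    (hirr : W.HasIrreducibleModPGaloisRep 3) (κ : ZpExtension ℚ 3) (hκ : κ.IsCyclotomic)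
    (hZ : letI : ContinuousSMul ℤ_[3] (W.tateModule 3) := TateModule.continuousSMul_padicInt
      haveI : Module.Free ℤ_[3] (W.tateModule 3) := W.module_free_tateModule_holds 3
      haveI : Module.Finite ℤ_[3] (W.tateModule 3) := W.module_finite_tateModule_holds 3
      ∀ (γ : absoluteGaloisGroup ℚ) (I : IwasawaH1Data W 3 κ γ), κ.IsTopGenerator γ →
        ∃ s : I.H, IsEulerSystemClass W 3 κ γ I s ∧
          s ∉ IwasawaAlgebra.augIdealP 3 • (⊤ : Submodule (IwasawaAlgebra 3) I.H)) :
    ∃ (γ : absoluteGaloisGroup ℚ) (D : W.FineSelmerDualData κ γ),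
      Module.Finite ℤ_[3] (RestrictScalars ℤ_[3] (IwasawaAlgebra 3) D.X) := by
  letI : ContinuousSMul ℤ_[3] (W.tateModule 3) := TateModule.continuousSMul_padicInt
  haveI : Module.Free ℤ_[3] (W.tateModule 3) := W.module_free_tateModule_holds 3
  haveI : Module.Finite ℤ_[3] (W.tateModule 3) := W.module_finite_tateModule_holds 3
  obtain ⟨γ, hγ⟩ : ∃ γ : absoluteGaloisGroup ℚ, κ.IsTopGenerator γ := κ.surjective (Multiplicative.ofAdd 1)
  obtain ⟨I⟩ := nonempty_iwasawaH1Data_holds W 3 κ γ hκ hγ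
  obtain ⟨D⟩ := W.nonempty_fineSelmerDualData κ hγ
  exact ⟨γ, D, moduleFinite_padicInt_fineSelmerDual_of_eulerClass_three_of_irr W hκ hγ hirr I D (hZ γ I hγ)⟩

end Three

/-! ## §3 Reading the hypothesis at a finite level: `s ∈ p·𝐇¹_Γ` forces `proj_n s ∈ p·H¹(ℚ_n, T_pW)` -/

section Level

variable {W : WeierstrassCurve ℚ} [W.IsElliptic] {p : ℕ} [Fact p.Prime]
  [ContinuousSMul ℤ_[p] (W.tateModule p)] {κ : ZpExtension ℚ p} {γ : absoluteGaloisGroup ℚ}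

/-- **`s ∈ p·𝐇¹_Γ(T_pW)` ⟹ every projection `proj_n s` is `p` times an (integral) class** (`p · 𝐇¹ = C(p) • 𝐇¹`
and `proj_n (C c • x) = c • proj_n x`, Kato §12.2): the Λ-adic `p`-divisibility is visible at every finite layer.
[cite: Kato2004Asterisque, §12.2 (p. 220)] [cite: Washington1997, §13.2] -/
theorem exists_proj_eq_smul_of_mem_augIdealP_smul (I : IwasawaH1Data W p κ γ) {s : I.H}
    (hs : s ∈ IwasawaAlgebra.augIdealP p • (⊤ : Submodule (IwasawaAlgebra p) I.H)) (n : ℕ) :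
    ∃ x : I.H, I.proj n s = (p : ℤ_[p]) • I.proj n x := by
  rw [IwasawaAlgebra.augIdealP, Submodule.ideal_span_singleton_smul, Submodule.mem_smul_pointwise_iff_exists]
    at hs
  obtain ⟨x, -, rfl⟩ := hs
  exact ⟨x, I.proj_C_smul _ n x⟩

/-- **Level-`n` certificate of `p`-INDIVISIBILITY in `𝐇¹_Γ`**: if for some layer `n` the class `proj_n s ∈ H¹(ℚ_n, T_pW)`
is not `p` times the projection of any element of `𝐇¹_Γ` — e.g. if `proj_0 s ∉ p · H¹(ℤ[1/p], T_pW)`, which for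
Kato's zeta class at a rank-`0` row reads off `ord_p(L(E,1)/Ω_E)` through `exp*` (Kato Thm. 12.5 (1), Kim 2026
Lemma 3.10) — then `s ∉ p·𝐇¹_Γ(T_pW)`: the displayed hypothesis of §1–§2 is checkable per row at level `0`.
[cite: Kato2004Asterisque, §12.2 (p. 220) and Thm. 12.5 (1) (p. 221)] [cite: Washington1997, §13.2] -/
theorem not_mem_augIdealP_smul_of_proj_ne (I : IwasawaH1Data W p κ γ) {s : I.H} {n : ℕ}
    (h : ∀ x : I.H, I.proj n s ≠ (p : ℤ_[p]) • I.proj n x) :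
    s ∉ IwasawaAlgebra.augIdealP p • (⊤ : Submodule (IwasawaAlgebra p) I.H) := by
  intro hs
  obtain ⟨x, hx⟩ := exists_proj_eq_smul_of_mem_augIdealP_smul I hs n
  exact h x hx

/-- The same with the test restricted to the INTEGRAL classes `H¹(ℤ_n[1/p], T_pW) ∋ proj_n x` (Kato §8.2, Lemma 8.5):
`proj_n s ∉ p · H¹(ℤ_n[1/p], T_pW)` ⟹ `s ∉ p·𝐇¹_Γ`. [cite: Kato2004Asterisque, §8.2, Lemma 8.5 (pp. 180–184), §12.2] -/
theorem not_mem_augIdealP_smul_of_proj_ne_smul_integral (I : IwasawaH1Data W p κ γ) {s : I.H} {n : ℕ}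
    (h : ∀ y ∈ integralH1 (tateRep W p) p (κ.layerSubgroup n), I.proj n s ≠ (p : ℤ_[p]) • y) :
    s ∉ IwasawaAlgebra.augIdealP p • (⊤ : Submodule (IwasawaAlgebra p) I.H) :=
  not_mem_augIdealP_smul_of_proj_ne I fun x ↦ h _ (I.proj_mem n x)

end Level

end Summit.BirchSwinnertonDyer.BirchSwinnertonDyer.Theorems.MuCoreIrr
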